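import Summits.CriticalPhenomena.PercolationContinuityZ3.Theorems.PercNearOneGluingNoHeavyLowerTailKnQuestion8CoefficientwiseCoreClassKernelMixBundleLP1
import Summits.CriticalPhenomena.PercolationContinuityZ3.Theorems.PercNearOneGluingNoHeavyLowerTailKnQuestion8CoefficientwiseCoreClassKernelMixIETLayerCakeClass
import HarnessLib

/-!
# THEOREM LP1(Θ) in the kernel, II: IET on every bundle for thread-supported levels (all up-sets, real levels)

Support file (`--supports stmt-CriticalPhenomena-4575`, closed), prover `prim-cplus-coupling` (gen 43).  No definitions, no notations, no named facts,
no sorries; standard axioms.  Memo `prim-cplus-coupling/A5-COUPLING-gen42.md` §7, `A5-COUPLING-gen43.md`.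

Part I (`…KernelMixBundleLP1`, `iet01_bundle_threadSupported_base`) is the 0/1 counting form of THEOREM LP1(Θ) for threads `p ≠ q` under the
normalisation `hᵃ{u} = kᵃ{u} = 0`.  Here:
* `Coefficientwise.iet01_bundle_threadSupported` — the normalisation is removed by the regime reduction `iet_regime_reduction` (the reduced levels of a
  thread-supported 0/1 system are again thread-supported 0/1);
* `Coefficientwise.iet01_bundle_oneThread` — the case `p = q` (all four a/b-levels supported on ONE thread): the D-side traces on a thread form a chain,
  so the two bad types cannot both occur, and one cross flow (`iet_cross_flow`) pays the remaining type (memo §7, 'pure lemma');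
* `Coefficientwise.iet_bundle_threadSupported` — **THEOREM (IET on bundles, thread-supported levels)**: for every explicit bundle `Θ(ℓ₁..ℓ_r)`, hubs
  `u, b`, threads `p, q` (equal or not), EVERY up-closed event `𝒱` and all monotone real levels `0 ≤ hᵃ, hᵇ ≤ h`, `0 ≤ kᵃ, kᵇ ≤ k` with `hᵃ, hᵇ`
  depending only on the trace on `V(W_p)` and `kᵃ, kᵇ` only on the trace on `V(W_q)` (`h, k` arbitrary):
    `0 ≤ Σ_{ω ∈ 𝒱 : b ∈ X∖Y} h(X)k(X) + Σ_{ω ∈ 𝒱 : b ∈ Y∖X} (hᵃX − hᵇY)(kᵃX − kᵇY)`,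
  by the class layer cake `iet_graph_of_indicator_levels_class`.  First IET theorem for bundles with `r ≥ 3` threads beyond the covered cases
  (`iet_of_supply_covers`); the thread-additive corollary (modular levels) is by bilinearity (sequel).
[cite: KozmaNitzan2024, Questions 8–9 (§5.5 p. 36) (context); Harris 1960]
-/

namespace Summit.CriticalPhenomena.PercolationContinuityZ3.Theorems

open Finset Literature.Probability.Percolation

namespace Coefficientwise

variable {ι V : Type*}

/-- For `a, c ∈ {0, 1}`: `(a − c)⁺ = a (1 − c)`. [folklore] -/
theorem max_sub_zero_of_zero_one {a c : ℝ} (ha : a = 0 ∨ a = 1) (hc : c = 0 ∨ c = 1) : max (a - c) 0 = a * (1 - c) := by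
  rcases ha with h1 | h1 <;> rcases hc with h2 | h2 <;> rw [h1, h2]
  · rw [sub_zero, max_self]; ring
  · rw [max_eq_right (by norm_num)]; ring
  · rw [max_eq_left (by norm_num)]; ring
  · rw [sub_self, max_self]; ring

open Classical in
/-- **THEOREM LP1(Θ), 0/1 counting form (threads `p ≠ q`, no normalisation).**  As `iet01_bundle_threadSupported_base` without the hypothesis
`hᵃ{u} = kᵃ{u} = 0`: the regime reduction `iet_regime_reduction` bounds the IET sum below by the IET sum of the reduced levels
`h(insert u ·) − hᵃ{u}, …, (hᵇ(insert u ·) − hᵃ{u})⁺, …`, which are again 0/1, thread-supported and vanish on `{u}`.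
[cite: KozmaNitzan2024, Questions 8–9 (§5.5 p. 36) (context)] -/
theorem iet01_bundle_threadSupported (ends : ι → Sym2 V) (r : ℕ) (L : ℕ → ℕ) (hL : ∀ t, t < r → 1 ≤ L t)
    (w : ℕ → ℕ → V) (e : ℕ → ℕ → ι) (u b : V)
    (hw0 : ∀ t, t < r → w t 0 = u) (hwL : ∀ t, t < r → w t (L t) = b)
    (harc : ∀ t, t < r → ∀ j, 1 ≤ j → j ≤ L t → ends (e t j) = s(w t (j - 1), w t j))
    (hwinj : ∀ t, t < r → ∀ i j, i ≤ L t → j ≤ L t → w t i = w t j → i = j)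
    (hcross : ∀ t t', t < r → t' < r → t ≠ t' → ∀ i j, i ≤ L t → j ≤ L t' → w t i = w t' j → (i = 0 ∧ j = 0) ∨ (i = L t ∧ j = L t'))
    (A : ℕ → Finset ι) (hA : ∀ t, t < r → ∀ i, i ∈ A t ↔ ∃ j, 1 ≤ j ∧ j ≤ L t ∧ e t j = i)
    (hAdisj : ∀ t t', t < r → t' < r → t ≠ t' → Disjoint (A t) (A t'))
    (E : Finset ι) (hEA : ∀ i, i ∈ E ↔ ∃ t, t < r ∧ i ∈ A t)
    (p q : ℕ) (hp : p < r) (hq : q < r) (hpq : p ≠ q)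
    (𝒱 : Finset ι → Prop) (hV : ∀ ⦃s t : Finset ι⦄, s ⊆ t → 𝒱 s → 𝒱 t)
    (h k ha hb ka kb : Set V → ℝ)
    (mha : Monotone ha) (mhb : Monotone hb) (mka : Monotone ka) (mkb : Monotone kb)
    (h01 : ∀ S, h S = 0 ∨ h S = 1) (k01 : ∀ S, k S = 0 ∨ k S = 1) (ha01 : ∀ S, ha S = 0 ∨ ha S = 1) (hb01 : ∀ S, hb S = 0 ∨ hb S = 1)
    (ka01 : ∀ S, ka S = 0 ∨ ka S = 1) (kb01 : ∀ S, kb S = 0 ∨ kb S = 1)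
    (hah : ∀ S, ha S ≤ h S) (hbh : ∀ S, hb S ≤ h S) (kak : ∀ S, ka S ≤ k S) (kbk : ∀ S, kb S ≤ k S)
    (sha : ∀ S S' : Set V, (∀ j, j ≤ L p → (w p j ∈ S ↔ w p j ∈ S')) → ha S = ha S')
    (shb : ∀ S S' : Set V, (∀ j, j ≤ L p → (w p j ∈ S ↔ w p j ∈ S')) → hb S = hb S')
    (ska : ∀ S S' : Set V, (∀ j, j ≤ L q → (w q j ∈ S ↔ w q j ∈ S')) → ka S = ka S')
    (skb : ∀ S S' : Set V, (∀ j, j ≤ L q → (w q j ∈ S ↔ w q j ∈ S')) → kb S = kb S') :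
    0 ≤ (∑ ω ∈ E.powerset, if 𝒱 ω ∧ b ∈ openCluster (ends '' (↑ω : Set ι)) u ∧ b ∉ openCluster (ends '' (↑(E \ ω) : Set ι)) u then
        h (openCluster (ends '' (↑ω : Set ι)) u) * k (openCluster (ends '' (↑ω : Set ι)) u) else 0)
      + ∑ ω ∈ E.powerset, if 𝒱 ω ∧ b ∈ openCluster (ends '' (↑(E \ ω) : Set ι)) u ∧ b ∉ openCluster (ends '' (↑ω : Set ι)) u then
        (ha (openCluster (ends '' (↑ω : Set ι)) u) - hb (openCluster (ends '' (↑(E \ ω) : Set ι)) u)) *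
          (ka (openCluster (ends '' (↑ω : Set ι)) u) - kb (openCluster (ends '' (↑(E \ ω) : Set ι)) u)) else 0 := by
  have nn : ∀ f : Set V → ℝ, (∀ S, f S = 0 ∨ f S = 1) → ∀ S, 0 ≤ f S := by
    intro f f01 S; rcases f01 S with h0 | h0 <;> simp [h0]
  set α₀ : ℝ := ha {u} with hα₀
  set γ₀ : ℝ := ka {u} with hγ₀
  set h₂ : Set V → ℝ := fun S => h (insert u S) - α₀ with hh₂
  set ha₂ : Set V → ℝ := fun S => ha (insert u S) - α₀ with hha₂
  set hb₂ : Set V → ℝ := fun S => max (hb (insert u S) - α₀) 0 with hhb₂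
  set k₂ : Set V → ℝ := fun S => k (insert u S) - γ₀ with hk₂
  set ka₂ : Set V → ℝ := fun S => ka (insert u S) - γ₀ with hka₂
  set kb₂ : Set V → ℝ := fun S => max (kb (insert u S) - γ₀) 0 with hkb₂
  have mins : Monotone (fun S : Set V => insert u S) := fun S T hST => Set.insert_subset_insert hST
  have huin : ∀ S : Set V, ({u} : Set V) ⊆ insert u S := fun S => Set.singleton_subset_iff.mpr (Set.mem_insert u S)
  have haα : ∀ S, α₀ ≤ ha (insert u S) := fun S => mha (huin S)
  have kaγ : ∀ S, γ₀ ≤ ka (insert u S) := fun S => mka (huin S)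
  -- 0/1-valuedness of the reduced levels
  have sub01 : ∀ (f : Set V → ℝ) (c : ℝ), (∀ S, f S = 0 ∨ f S = 1) → (c = 0 ∨ c = 1) → (∀ S, c ≤ f (insert u S)) →
      ∀ S, f (insert u S) - c = 0 ∨ f (insert u S) - c = 1 := by
    intro f c f01 c01 hcf S
    rcases f01 (insert u S) with h0 | h0 <;> rcases c01 with h1 | h1
    · left; rw [h0, h1]; norm_num
    · exfalso; have := hcf S; rw [h0, h1] at this; linarith
    · right; rw [h0, h1]; norm_num
    · left; rw [h0, h1]; norm_num
  have max01 : ∀ (f : Set V → ℝ) (c : ℝ), (∀ S, f S = 0 ∨ f S = 1) → (c = 0 ∨ c = 1) →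
      ∀ S, max (f (insert u S) - c) 0 = 0 ∨ max (f (insert u S) - c) 0 = 1 := by
    intro f c f01 c01 S
    rw [max_sub_zero_of_zero_one (f01 _) c01]
    rcases f01 (insert u S) with h0 | h0 <;> rcases c01 with h1 | h1 <;> rw [h0, h1] <;> norm_num
  -- thread support is kept under `insert u` and the shifts
  have agreeIns : ∀ (t : ℕ) (S S' : Set V), (∀ j, j ≤ L t → (w t j ∈ S ↔ w t j ∈ S')) →
      ∀ j, j ≤ L t → (w t j ∈ insert u S ↔ w t j ∈ insert u S') := by
    intro t S S' hSS' j hj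
    simp only [Set.mem_insert_iff, hSS' j hj]
  have red := iet_regime_reduction ends E u b 𝒱 hV h k ha hb ka kb mha mhb mka mkb (nn ha ha01) hah (nn hb hb01) hbh
    (nn ka ka01) kak (nn kb kb01) kbk
  have base := iet01_bundle_threadSupported_base ends r L hL w e u b hw0 hwL harc hwinj hcross A hA hAdisj E hEA p q hp hq hpq 𝒱 hV
    h₂ k₂ ha₂ hb₂ ka₂ kb₂
    (fun S T hST => sub_le_sub_right (mha (mins hST)) _) (fun S T hST => max_le_max (sub_le_sub_right (mhb (mins hST)) _) (le_refl 0))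
    (fun S T hST => sub_le_sub_right (mka (mins hST)) _) (fun S T hST => max_le_max (sub_le_sub_right (mkb (mins hST)) _) (le_refl 0))
    (sub01 h α₀ h01 (ha01 {u}) (fun S => le_trans (haα S) (hah _))) (sub01 k γ₀ k01 (ka01 {u}) (fun S => le_trans (kaγ S) (kak _)))
    (sub01 ha α₀ ha01 (ha01 {u}) haα) (max01 hb α₀ hb01 (ha01 {u})) (sub01 ka γ₀ ka01 (ka01 {u}) kaγ) (max01 kb γ₀ kb01 (ka01 {u}))
    (fun S => sub_le_sub_right (hah _) _) (fun S => max_le (sub_le_sub_right (hbh _) _) (sub_nonneg.mpr (le_trans (haα S) (hah _))))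
    (fun S => sub_le_sub_right (kak _) _) (fun S => max_le (sub_le_sub_right (kbk _) _) (sub_nonneg.mpr (le_trans (kaγ S) (kak _))))
    (fun S S' hSS' => by simp only [hha₂, sha _ _ (agreeIns p S S' hSS')])
    (fun S S' hSS' => by simp only [hhb₂, shb _ _ (agreeIns p S S' hSS')])
    (fun S S' hSS' => by simp only [hka₂, ska _ _ (agreeIns q S S' hSS')])
    (fun S S' hSS' => by simp only [hkb₂, skb _ _ (agreeIns q S S' hSS')])
    (by simp only [hha₂, Set.insert_eq_of_mem (Set.mem_singleton u), hα₀, sub_self])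
    (by simp only [hka₂, Set.insert_eq_of_mem (Set.mem_singleton u), hγ₀, sub_self])
  simp only [hh₂, hk₂, hha₂, hhb₂, hka₂, hkb₂] at base
  exact le_trans base red

open Classical in
/-- **The one-thread case (`p = q`).**  On an explicit bundle, for 0/1 monotone levels with ALL FOUR of `hᵃ, hᵇ, kᵃ, kᵇ` supported on the vertices of
one thread `p` (`hᵃ, hᵇ ≤ h`, `kᵃ, kᵇ ≤ k`), the IET sum over every up-closed `𝒱` is nonnegative.  Proof: at demand points the red trace on thread `p`
is an initial segment, so two demand points `ω₁ ∈ bad₁` (`hᵃX = 1, kᵃX = 0`) and `ω₂ ∈ bad₂` (`kᵃX = 1, hᵃX = 0`) would have nested traces —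
impossible; the surviving bad type is paid by one cross flow `iet_cross_flow` into the supply, and `iet01_ge_count` concludes (memo gen 42 §7, the
'pure lemma' case). [cite: KozmaNitzan2024, Questions 8–9 (§5.5 p. 36) (context); Harris 1960] -/
theorem iet01_bundle_oneThread (ends : ι → Sym2 V) (r : ℕ) (L : ℕ → ℕ) (hL : ∀ t, t < r → 1 ≤ L t)
    (w : ℕ → ℕ → V) (e : ℕ → ℕ → ι) (u b : V)
    (hw0 : ∀ t, t < r → w t 0 = u) (hwL : ∀ t, t < r → w t (L t) = b)
    (harc : ∀ t, t < r → ∀ j, 1 ≤ j → j ≤ L t → ends (e t j) = s(w t (j - 1), w t j))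
    (hwinj : ∀ t, t < r → ∀ i j, i ≤ L t → j ≤ L t → w t i = w t j → i = j)
    (hcross : ∀ t t', t < r → t' < r → t ≠ t' → ∀ i j, i ≤ L t → j ≤ L t' → w t i = w t' j → (i = 0 ∧ j = 0) ∨ (i = L t ∧ j = L t'))
    (A : ℕ → Finset ι) (hA : ∀ t, t < r → ∀ i, i ∈ A t ↔ ∃ j, 1 ≤ j ∧ j ≤ L t ∧ e t j = i)
    (E : Finset ι) (hEA : ∀ i, i ∈ E ↔ ∃ t, t < r ∧ i ∈ A t)
    (p : ℕ) (hp : p < r)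
    (𝒱 : Finset ι → Prop) (hV : ∀ ⦃s t : Finset ι⦄, s ⊆ t → 𝒱 s → 𝒱 t)
    (h k ha hb ka kb : Set V → ℝ)
    (mha : Monotone ha) (mhb : Monotone hb) (mka : Monotone ka) (mkb : Monotone kb)
    (h01 : ∀ S, h S = 0 ∨ h S = 1) (k01 : ∀ S, k S = 0 ∨ k S = 1) (ha01 : ∀ S, ha S = 0 ∨ ha S = 1) (hb01 : ∀ S, hb S = 0 ∨ hb S = 1)
    (ka01 : ∀ S, ka S = 0 ∨ ka S = 1) (kb01 : ∀ S, kb S = 0 ∨ kb S = 1)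
    (hah : ∀ S, ha S ≤ h S) (hbh : ∀ S, hb S ≤ h S) (kak : ∀ S, ka S ≤ k S) (kbk : ∀ S, kb S ≤ k S)
    (sha : ∀ S S' : Set V, (∀ j, j ≤ L p → (w p j ∈ S ↔ w p j ∈ S')) → ha S = ha S')
    (ska : ∀ S S' : Set V, (∀ j, j ≤ L p → (w p j ∈ S ↔ w p j ∈ S')) → ka S = ka S') :
    0 ≤ (∑ ω ∈ E.powerset, if 𝒱 ω ∧ b ∈ openCluster (ends '' (↑ω : Set ι)) u ∧ b ∉ openCluster (ends '' (↑(E \ ω) : Set ι)) u then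
        h (openCluster (ends '' (↑ω : Set ι)) u) * k (openCluster (ends '' (↑ω : Set ι)) u) else 0)
      + ∑ ω ∈ E.powerset, if 𝒱 ω ∧ b ∈ openCluster (ends '' (↑(E \ ω) : Set ι)) u ∧ b ∉ openCluster (ends '' (↑ω : Set ι)) u then
        (ha (openCluster (ends '' (↑ω : Set ι)) u) - hb (openCluster (ends '' (↑(E \ ω) : Set ι)) u)) *
          (ka (openCluster (ends '' (↑ω : Set ι)) u) - kb (openCluster (ends '' (↑(E \ ω) : Set ι)) u)) else 0 := by
  set C : Finset ι → Set V := fun ω => openCluster (ends '' (↑ω : Set ι)) u with hC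
  have nn : ∀ f : Set V → ℝ, (∀ S, f S = 0 ∨ f S = 1) → ∀ S, 0 ≤ f S := by
    intro f f01 S; rcases f01 S with h0 | h0 <;> simp [h0]
  -- ## the two bad types exclude each other (chain of D-side traces on thread p)
  have excl : ∀ ω₁ ω₂ : Finset ι, ω₁ ⊆ E → ω₂ ⊆ E → b ∉ C ω₁ → b ∉ C ω₂ →
      ha (C ω₁) = 1 → ka (C ω₁) = 0 → ka (C ω₂) = 1 → ha (C ω₂) = 0 → False := by
    intro ω₁ ω₂ h1E h2E hb1 hb2 e1 e2 e3 e4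
    have tr1 := fun j hj => bundle_traceD_iff ends r L hL w e u b hw0 hwL harc hwinj hcross A hA E hEA ω₁ h1E hb1 p hp j hj
    have tr2 := fun j hj => bundle_traceD_iff ends r L hL w e u b hw0 hwL harc hwinj hcross A hA E hEA ω₂ h2E hb2 p hp j hj
    have nested : (∀ j, j ≤ L p → w p j ∈ C ω₁ → w p j ∈ C ω₂) ∨ (∀ j, j ≤ L p → w p j ∈ C ω₂ → w p j ∈ C ω₁) := by
      by_contra hcon
      rw [not_or] at hcon
      obtain ⟨hA', hB'⟩ := hcon
      push Not at hA' hB'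
      obtain ⟨j₁, hj₁, hin₁, hout₁⟩ := hA'
      obtain ⟨j₂, hj₂, hin₂, hout₂⟩ := hB'
      have hin₁' := (tr1 j₁ hj₁).mp hin₁
      have hin₂' := (tr2 j₂ hj₂).mp hin₂
      rw [Set.mem_setOf_eq] at hin₁' hin₂'
      obtain ⟨j₁', hj₁', heq₁, run₁⟩ := hin₁'
      have hjj₁ : j₁ = j₁' := hwinj p hp j₁ j₁' hj₁ (le_of_lt hj₁') heq₁
      obtain ⟨j₂', hj₂', heq₂, run₂⟩ := hin₂'
      have hjj₂ : j₂ = j₂' := hwinj p hp j₂ j₂' hj₂ (le_of_lt hj₂') heq₂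
      rcases le_or_gt j₁ j₂ with hle | hlt
      · apply hout₁
        rw [show (w p j₁ ∈ C ω₂) = (w p j₁ ∈ openCluster (ends '' (↑ω₂ : Set ι)) u) from rfl, tr2 j₁ hj₁, Set.mem_setOf_eq]
        exact ⟨j₁', hj₁', heq₁, fun j' h1 h2 => run₂ j' h1 (by omega)⟩
      · apply hout₂
        rw [show (w p j₂ ∈ C ω₁) = (w p j₂ ∈ openCluster (ends '' (↑ω₁ : Set ι)) u) from rfl, tr1 j₂ hj₂, Set.mem_setOf_eq]
        exact ⟨j₂', hj₂', heq₂, fun j' h1 h2 => run₁ j' h1 (by omega)⟩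
    -- the traces as vertex sets
    set S₁ : Set V := {x | ∃ j, j ≤ L p ∧ x = w p j ∧ w p j ∈ C ω₁} with hS₁
    set S₂ : Set V := {x | ∃ j, j ≤ L p ∧ x = w p j ∧ w p j ∈ C ω₂} with hS₂
    have agree₁ : ∀ j, j ≤ L p → (w p j ∈ C ω₁ ↔ w p j ∈ S₁) := by
      intro j hj; constructor
      · intro hm; exact ⟨j, hj, rfl, hm⟩
      · rintro ⟨j', hj', heq, hm⟩
        rw [hwinj p hp j j' hj hj' heq]; exact hm
    have agree₂ : ∀ j, j ≤ L p → (w p j ∈ C ω₂ ↔ w p j ∈ S₂) := by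
      intro j hj; constructor
      · intro hm; exact ⟨j, hj, rfl, hm⟩
      · rintro ⟨j', hj', heq, hm⟩
        rw [hwinj p hp j j' hj hj' heq]; exact hm
    rcases nested with hsub | hsub
    · have hS : S₁ ⊆ S₂ := by
        rintro x ⟨j, hj, rfl, hm⟩; exact ⟨j, hj, rfl, hsub j hj hm⟩
      have hle := mha hS
      rw [← sha _ _ agree₁, ← sha _ _ agree₂, e1, e4] at hle; linarith
    · have hS : S₂ ⊆ S₁ := by
        rintro x ⟨j, hj, rfl, hm⟩; exact ⟨j, hj, rfl, hsub j hj hm⟩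
      have hle := mka hS
      rw [← ska _ _ agree₂, ← ska _ _ agree₁, e3, e2] at hle; linarith
  -- ## the 0/1 form dominates the count
  have cnt : (∑ ω ∈ E.powerset, if (𝒱 ω ∧ b ∈ C ω ∧ b ∉ C (E \ ω)) ∧ h (C ω) = 1 ∧ k (C ω) = 1 then (1 : ℝ) else 0)
      + (∑ ω ∈ E.powerset, if (𝒱 ω ∧ b ∈ C (E \ ω) ∧ b ∉ C ω) ∧ ha (C ω) = 1 ∧ ka (C ω) = 1 ∧ hb (C (E \ ω)) = 0 ∧ kb (C (E \ ω)) = 0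
          then (1 : ℝ) else 0)
      - (∑ ω ∈ E.powerset, if (𝒱 ω ∧ b ∈ C (E \ ω) ∧ b ∉ C ω) ∧ ha (C ω) = 1 ∧ kb (C (E \ ω)) = 1 ∧ hb (C (E \ ω)) = 0 ∧ ka (C ω) = 0
          then (1 : ℝ) else 0)
      - (∑ ω ∈ E.powerset, if (𝒱 ω ∧ b ∈ C (E \ ω) ∧ b ∉ C ω) ∧ hb (C (E \ ω)) = 1 ∧ ka (C ω) = 1 ∧ ha (C ω) = 0 ∧ kb (C (E \ ω)) = 0
          then (1 : ℝ) else 0)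
    ≤ (∑ ω ∈ E.powerset, if 𝒱 ω ∧ b ∈ C ω ∧ b ∉ C (E \ ω) then h (C ω) * k (C ω) else 0)
      + ∑ ω ∈ E.powerset, if 𝒱 ω ∧ b ∈ C (E \ ω) ∧ b ∉ C ω then (ha (C ω) - hb (C (E \ ω))) * (ka (C ω) - kb (C (E \ ω))) else 0 :=
    iet01_ge_count E (fun ω => 𝒱 ω ∧ b ∈ C ω ∧ b ∉ C (E \ ω)) (fun ω => 𝒱 ω ∧ b ∈ C (E \ ω) ∧ b ∉ C ω)
      C (fun ω => C (E \ ω)) h k ha hb ka kb h01 k01 ha01 hb01 ka01 kb01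
  have P1nn : 0 ≤ ∑ ω ∈ E.powerset, (if (𝒱 ω ∧ b ∈ C (E \ ω) ∧ b ∉ C ω) ∧ ha (C ω) = 1 ∧ ka (C ω) = 1 ∧ hb (C (E \ ω)) = 0 ∧ kb (C (E \ ω)) = 0
          then (1 : ℝ) else 0) := Finset.sum_nonneg fun ω _ => by split_ifs <;> norm_num
  -- ## the supply indicator dominates a product of 0/1 levels
  have supply : ∀ ω ∈ E.powerset, ∀ (f g : Set V → ℝ), (∀ S, f S = 0 ∨ f S = 1) → (∀ S, g S = 0 ∨ g S = 1) → (∀ S, f S ≤ h S) → (∀ S, g S ≤ k S) →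
      ∀ x y : ℝ, 0 ≤ x → 0 ≤ y →
      (if 𝒱 ω ∧ b ∈ C ω ∧ b ∉ C (E \ ω) then max (f (C ω) - x) 0 * max (g (C ω) - y) 0 else 0)
        ≤ (if (𝒱 ω ∧ b ∈ C ω ∧ b ∉ C (E \ ω)) ∧ h (C ω) = 1 ∧ k (C ω) = 1 then (1 : ℝ) else 0) := by
    intro ω _ f g f01 g01 hf hg x y hx hy
    by_cases hR : 𝒱 ω ∧ b ∈ C ω ∧ b ∉ C (E \ ω)
    · rw [if_pos hR]
      have m1 : max (f (C ω) - x) 0 ≤ f (C ω) := max_le (sub_le_self _ hx) (nn f f01 _)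
      have m2 : max (g (C ω) - y) 0 ≤ g (C ω) := max_le (sub_le_self _ hy) (nn g g01 _)
      have prod : max (f (C ω) - x) 0 * max (g (C ω) - y) 0 ≤ f (C ω) * g (C ω) :=
        mul_le_mul m1 m2 (le_max_right _ _) (nn f f01 _)
      have fk : f (C ω) * g (C ω) ≤ h (C ω) * k (C ω) := mul_le_mul (hf _) (hg _) (nn g g01 _) (le_trans (nn f f01 _) (hf _))
      have hk : h (C ω) * k (C ω) ≤ (if (𝒱 ω ∧ b ∈ C ω ∧ b ∉ C (E \ ω)) ∧ h (C ω) = 1 ∧ k (C ω) = 1 then (1 : ℝ) else 0) := by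
        rcases h01 (C ω) with e5 | e5 <;> rcases k01 (C ω) with e6 | e6 <;> simp [hR, e5, e6]
      linarith
    · rw [if_neg hR, if_neg (fun hc => hR hc.1)]
  -- ## flow 1: bad₁ ≤ supply, flow 2: bad₂ ≤ supply
  have fl1 : (∑ ω ∈ E.powerset, if (𝒱 ω ∧ b ∈ C (E \ ω) ∧ b ∉ C ω) ∧ ha (C ω) = 1 ∧ kb (C (E \ ω)) = 1 ∧ hb (C (E \ ω)) = 0 ∧ ka (C ω) = 0
          then (1 : ℝ) else 0)
      ≤ ∑ ω ∈ E.powerset, if (𝒱 ω ∧ b ∈ C ω ∧ b ∉ C (E \ ω)) ∧ h (C ω) = 1 ∧ k (C ω) = 1 then (1 : ℝ) else 0 := by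
    have cf : (∑ ω ∈ E.powerset, if 𝒱 ω ∧ b ∈ C (E \ ω) ∧ b ∉ C ω then
          max (ha (C ω) - hb (C (E \ ω))) 0 * max (kb (C (E \ ω)) - ka (C ω)) 0 else 0)
        ≤ ∑ ω ∈ E.powerset, if 𝒱 ω ∧ b ∈ C ω ∧ b ∉ C (E \ ω) then
          max (ha (C ω) - hb (C (E \ ω))) 0 * max (kb (C ω) - ka (C (E \ ω))) 0 else 0 :=
      iet_cross_flow ends E u b 𝒱 hV ha hb kb ka mha mhb mkb mka
    refine le_trans (le_of_eq (Finset.sum_congr rfl fun ω _ => ?_)) (le_trans cf (Finset.sum_le_sum fun ω hω => ?_))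
    · by_cases hD : 𝒱 ω ∧ b ∈ C (E \ ω) ∧ b ∉ C ω
      · rw [max_sub_zero_of_zero_one (ha01 _) (hb01 _), max_sub_zero_of_zero_one (kb01 _) (ka01 _)]
        rcases ha01 (C ω) with e1 | e1 <;> rcases hb01 (C (E \ ω)) with e2 | e2 <;> rcases ka01 (C ω) with e3 | e3 <;>
          rcases kb01 (C (E \ ω)) with e4 | e4 <;> norm_num [hD, e1, e2, e3, e4]
      · rw [if_neg (fun hc => hD hc.1), if_neg hD]
    · exact supply ω hω ha kb ha01 kb01 hah kbk _ _ (nn hb hb01 _) (nn ka ka01 _)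
  have fl2 : (∑ ω ∈ E.powerset, if (𝒱 ω ∧ b ∈ C (E \ ω) ∧ b ∉ C ω) ∧ hb (C (E \ ω)) = 1 ∧ ka (C ω) = 1 ∧ ha (C ω) = 0 ∧ kb (C (E \ ω)) = 0
          then (1 : ℝ) else 0)
      ≤ ∑ ω ∈ E.powerset, if (𝒱 ω ∧ b ∈ C ω ∧ b ∉ C (E \ ω)) ∧ h (C ω) = 1 ∧ k (C ω) = 1 then (1 : ℝ) else 0 := by
    have cf : (∑ ω ∈ E.powerset, if 𝒱 ω ∧ b ∈ C (E \ ω) ∧ b ∉ C ω then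
          max (ka (C ω) - kb (C (E \ ω))) 0 * max (hb (C (E \ ω)) - ha (C ω)) 0 else 0)
        ≤ ∑ ω ∈ E.powerset, if 𝒱 ω ∧ b ∈ C ω ∧ b ∉ C (E \ ω) then
          max (ka (C ω) - kb (C (E \ ω))) 0 * max (hb (C ω) - ha (C (E \ ω))) 0 else 0 :=
      iet_cross_flow ends E u b 𝒱 hV ka kb hb ha mka mkb mhb mha
    refine le_trans (le_of_eq (Finset.sum_congr rfl fun ω _ => ?_)) (le_trans cf (Finset.sum_le_sum fun ω hω => ?_))
    · by_cases hD : 𝒱 ω ∧ b ∈ C (E \ ω) ∧ b ∉ C ω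
      · rw [max_sub_zero_of_zero_one (ka01 _) (kb01 _), max_sub_zero_of_zero_one (hb01 _) (ha01 _)]
        rcases ha01 (C ω) with e1 | e1 <;> rcases hb01 (C (E \ ω)) with e2 | e2 <;> rcases ka01 (C ω) with e3 | e3 <;>
          rcases kb01 (C (E \ ω)) with e4 | e4 <;> norm_num [hD, e1, e2, e3, e4]
      · rw [if_neg (fun hc => hD hc.1), if_neg hD]
    · have key := supply ω hω hb ka hb01 ka01 hbh kak (ha (C (E \ ω))) (kb (C (E \ ω))) (nn ha ha01 _) (nn kb kb01 _)
      by_cases hR : 𝒱 ω ∧ b ∈ C ω ∧ b ∉ C (E \ ω)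
      · rw [if_pos hR] at key ⊢; rw [mul_comm]; exact key
      · rw [if_neg hR, if_neg (fun hc => hR hc.1)]
  -- ## one of the two bad sums vanishes
  by_cases hex : ∃ ω ∈ E.powerset, (b ∈ C (E \ ω) ∧ b ∉ C ω) ∧ ka (C ω) = 1 ∧ ha (C ω) = 0
  · obtain ⟨ω₂, hω₂, ⟨-, hb₂⟩, g3, g4⟩ := hex
    have z1 : (∑ ω ∈ E.powerset, if (𝒱 ω ∧ b ∈ C (E \ ω) ∧ b ∉ C ω) ∧ ha (C ω) = 1 ∧ kb (C (E \ ω)) = 1 ∧ hb (C (E \ ω)) = 0 ∧ ka (C ω) = 0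
          then (1 : ℝ) else 0) = 0 := by
      refine Finset.sum_eq_zero fun ω hω => if_neg fun hc => ?_
      exact excl ω ω₂ (Finset.mem_powerset.mp hω) (Finset.mem_powerset.mp hω₂) hc.1.2.2 hb₂ hc.2.1 hc.2.2.2.2 g3 g4
    linarith
  · have z2 : (∑ ω ∈ E.powerset, if (𝒱 ω ∧ b ∈ C (E \ ω) ∧ b ∉ C ω) ∧ hb (C (E \ ω)) = 1 ∧ ka (C ω) = 1 ∧ ha (C ω) = 0 ∧ kb (C (E \ ω)) = 0
          then (1 : ℝ) else 0) = 0 := by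
      refine Finset.sum_eq_zero fun ω hω => if_neg fun hc => hex ?_
      exact ⟨ω, hω, ⟨hc.1.2.1, hc.1.2.2⟩, hc.2.2.1, hc.2.2.2.1⟩
    linarith

open Classical in
/-- **THEOREM (IET on every bundle for thread-supported levels; all up-sets, real levels).**  Let the bundle `Θ(ℓ₁..ℓ_r)` through the hubs `u, b`
be given explicitly (threads `w t 0 = u, …, w t (L t) = b` meeting only at the hubs, edge sets `A t` pairwise disjoint, `E = ⋃ A t`), and let
`p, q < r` be threads (equal or not).  For EVERY up-closed event `𝒱` and all monotone `h, k` and monotone levels `0 ≤ hᵃ, hᵇ ≤ h`, `0 ≤ kᵃ, kᵇ ≤ k`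
such that `hᵃ, hᵇ` depend only on the trace on the vertices of thread `p` and `kᵃ, kᵇ` only on the trace on the vertices of thread `q`:
  `0 ≤ Σ_{ω ⊆ E : 𝒱 ω, b ∈ C_u ω ∖ C_u(E∖ω)} h(C_u ω) k(C_u ω) + Σ_{ω ⊆ E : 𝒱 ω, b ∈ C_u(E∖ω) ∖ C_u ω} (hᵃ(C_u ω) − hᵇ(C_u(E∖ω)))(kᵃ(C_u ω) − kᵇ(C_u(E∖ω)))`.
(Memo gen 42 §7: THEOREM LP1(Θ) + layer cake; e.g. principal levels `1[x ∈ ·]`, `x` on thread `p`, `1[z ∈ ·]`, `z` on thread `q`.)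
[cite: KozmaNitzan2024, Questions 8–9 (§5.5 p. 36) (context); Harris 1960] -/
theorem iet_bundle_threadSupported (ends : ι → Sym2 V) (r : ℕ) (L : ℕ → ℕ) (hL : ∀ t, t < r → 1 ≤ L t)
    (w : ℕ → ℕ → V) (e : ℕ → ℕ → ι) (u b : V)
    (hw0 : ∀ t, t < r → w t 0 = u) (hwL : ∀ t, t < r → w t (L t) = b)
    (harc : ∀ t, t < r → ∀ j, 1 ≤ j → j ≤ L t → ends (e t j) = s(w t (j - 1), w t j))
    (hwinj : ∀ t, t < r → ∀ i j, i ≤ L t → j ≤ L t → w t i = w t j → i = j)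
    (hcross : ∀ t t', t < r → t' < r → t ≠ t' → ∀ i j, i ≤ L t → j ≤ L t' → w t i = w t' j → (i = 0 ∧ j = 0) ∨ (i = L t ∧ j = L t'))
    (A : ℕ → Finset ι) (hA : ∀ t, t < r → ∀ i, i ∈ A t ↔ ∃ j, 1 ≤ j ∧ j ≤ L t ∧ e t j = i)
    (hAdisj : ∀ t t', t < r → t' < r → t ≠ t' → Disjoint (A t) (A t'))
    (E : Finset ι) (hEA : ∀ i, i ∈ E ↔ ∃ t, t < r ∧ i ∈ A t)
    (p q : ℕ) (hp : p < r) (hq : q < r)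
    (𝒱 : Finset ι → Prop) (hV : ∀ ⦃s t : Finset ι⦄, s ⊆ t → 𝒱 s → 𝒱 t)
    (h k ha hb ka kb : Set V → ℝ)
    (mh : Monotone h) (mk : Monotone k) (mha : Monotone ha) (mhb : Monotone hb) (mka : Monotone ka) (mkb : Monotone kb)
    (ha0 : ∀ S, 0 ≤ ha S) (hah : ∀ S, ha S ≤ h S) (hb0 : ∀ S, 0 ≤ hb S) (hbh : ∀ S, hb S ≤ h S)
    (ka0 : ∀ S, 0 ≤ ka S) (kak : ∀ S, ka S ≤ k S) (kb0 : ∀ S, 0 ≤ kb S) (kbk : ∀ S, kb S ≤ k S)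
    (sha : ∀ S S' : Set V, (∀ j, j ≤ L p → (w p j ∈ S ↔ w p j ∈ S')) → ha S = ha S')
    (shb : ∀ S S' : Set V, (∀ j, j ≤ L p → (w p j ∈ S ↔ w p j ∈ S')) → hb S = hb S')
    (ska : ∀ S S' : Set V, (∀ j, j ≤ L q → (w q j ∈ S ↔ w q j ∈ S')) → ka S = ka S')
    (skb : ∀ S S' : Set V, (∀ j, j ≤ L q → (w q j ∈ S ↔ w q j ∈ S')) → kb S = kb S') :
    0 ≤ (∑ ω ∈ E.powerset, if 𝒱 ω ∧ b ∈ openCluster (ends '' (↑ω : Set ι)) u ∧ b ∉ openCluster (ends '' (↑(E \ ω) : Set ι)) u then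
        h (openCluster (ends '' (↑ω : Set ι)) u) * k (openCluster (ends '' (↑ω : Set ι)) u) else 0)
      + ∑ ω ∈ E.powerset, if 𝒱 ω ∧ b ∈ openCluster (ends '' (↑(E \ ω) : Set ι)) u ∧ b ∉ openCluster (ends '' (↑ω : Set ι)) u then
        (ha (openCluster (ends '' (↑ω : Set ι)) u) - hb (openCluster (ends '' (↑(E \ ω) : Set ι)) u)) *
          (ka (openCluster (ends '' (↑ω : Set ι)) u) - kb (openCluster (ends '' (↑(E \ ω) : Set ι)) u)) else 0 := by
  refine iet_graph_of_indicator_levels_class ends E u b 𝒱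
    (fun f => ∀ S S' : Set V, (∀ j, j ≤ L p → (w p j ∈ S ↔ w p j ∈ S')) → f S = f S')
    (fun f => ∀ S S' : Set V, (∀ j, j ≤ L q → (w q j ∈ S ↔ w q j ∈ S')) → f S = f S') ?_ ?_ ?_
    h k ha hb ka kb mh mk mha mhb mka mkb ha0 hah hb0 hbh ka0 kak kb0 kbk sha shb ska skb
  · intro f c hf S S' hSS'
    simp only [hf S S' hSS']
  · intro f c hf S S' hSS'
    simp only [hf S S' hSS']
  · intro h' k' ha' hb' ka' kb' _ _ mha' mhb' mka' mkb' h01 k01 ha01 hb01 ka01 kb01 hah' hbh' kak' kbk' sha' shb' ska' skb'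
    by_cases hpq : p = q
    · have ska'' : ∀ S S' : Set V, (∀ j, j ≤ L p → (w p j ∈ S ↔ w p j ∈ S')) → ka' S = ka' S' := by rw [hpq]; exact ska'
      exact iet01_bundle_oneThread ends r L hL w e u b hw0 hwL harc hwinj hcross A hA E hEA p hp 𝒱 hV h' k' ha' hb' ka' kb'
        mha' mhb' mka' mkb' h01 k01 ha01 hb01 ka01 kb01 hah' hbh' kak' kbk' sha' ska''
    · exact iet01_bundle_threadSupported ends r L hL w e u b hw0 hwL harc hwinj hcross A hA hAdisj E hEA p q hp hq hpq 𝒱 hV h' k' ha' hb' ka' kb'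
        mha' mhb' mka' mkb' h01 k01 ha01 hb01 ka01 kb01 hah' hbh' kak' kbk' sha' shb' ska' skb'

end Coefficientwise

end Summit.CriticalPhenomena.PercolationContinuityZ3.Theorems
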